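import Mathlib
import HarnessLib
import Summits.CriticalPhenomena.SAWScalingLimit.Theses.SAWTotalPositivity

/-!
# Sketch — first lemma of the crux idea `arc-summed-reverse-simon-lieb` (strategist, 2026-08-17)
for crux `SAWTotalPositivity.TPToTraversalBound` (stmt-CriticalPhenomena-10687).  Folder-local; nothing proved.

`QMBox` is the n × n box instance (mesh 1) of the arc-summed reverse Simon–Lieb / quasi-multiplicativity
inequality (QM) of `Cruxes/TPToTraversalBound/STRATEGY-CENSUS.md` §4(v):
  Σ_{q' ∈ arc} Z(t,q')·Z(q',b) ≤ C · Z(t,b) · Σ_{q' ∈ arc} Z(q',z)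
with t = left-mid, b = right-mid, arc = the bottom side, z = top-mid.  Enumerated C_needed = 1.62, 1.27, 1.86, 1.50
for n = 3, 4, 5, 6 (`ExitMassEnumeration.md` §4).
-/

namespace Summit.CriticalPhenomena.SAWScalingLimit.Cruxes.TPToTraversalBound.SketchStrategist

open scoped BigOperators ENNReal
open MeasureTheory Literature.Probability.LatticeModels
open Literature.Probability.RandomPlanarGeometry

noncomputable section

/-- The open box `(-1, n) × (-1, n)`; at mesh `1` its lattice sites are `{0,…,n-1}²` with all nearest-neighbour edges. -/
def boxDomain (n : ℕ) : Set ℂ :=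
  {w | -1 < w.re ∧ w.re < n ∧ -1 < w.im ∧ w.im < n}

/-- The critical kernel of the box at mesh 1. -/
abbrev Zbox (n : ℕ) (u v : Site 2) : ℝ≥0∞ := SAW.weight (boxDomain n) 1 u v Set.univ

/-- **QMBox** (conjecture; first lemma of the idea `arc-summed-reverse-simon-lieb`): ONE constant `C` such that for
every `n ≥ 3`, in the `n × n` site box with `t = (0, ⌊n/2⌋)`, `b = (n-1, ⌊n/2⌋)`, `z = (⌊n/2⌋, n-1)` and the arc = the
bottom row `{(a, 0)}`,  `Σ_a Z(t,(a,0))·Z((a,0),b) ≤ C · Z(t,b) · Σ_a Z((a,0),z)`.  Dimensionally balanced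
(both sides `≍ δ^{h_t+h_b} · n · δ^{2h-1}` with `δ = 1/n`); TP₂ gives only the companion with `Z(b,z)` in place of
`Z((a,0),b)`. -/
def QMBox : Prop :=
  ∃ C : ℝ≥0∞, C ≠ ⊤ ∧ ∀ n : ℕ, 3 ≤ n →
    let t : Site 2 := ![0, (n : ℤ) / 2]
    let b : Site 2 := ![(n : ℤ) - 1, (n : ℤ) / 2]
    let z : Site 2 := ![(n : ℤ) / 2, (n : ℤ) - 1]
    (∑ a ∈ Finset.range n, Zbox n t ![(a : ℤ), 0] * Zbox n ![(a : ℤ), 0] b)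
      ≤ C * Zbox n t b * ∑ a ∈ Finset.range n, Zbox n ![(a : ℤ), 0] z

end

end Summit.CriticalPhenomena.SAWScalingLimit.Cruxes.TPToTraversalBound.SketchStrategist
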